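import Summits.NavierStokesRegularity.NavierStokesRegularity.Theorems.ExtremiserTransienceNearExtremalTransienceExtremiserLiouvilleNoAnalyticExtremalResidue
import Summits.NavierStokesRegularity.NavierStokesRegularity.Theorems.ExtremiserTransienceNearExtremalTransienceExtremiserLiouvillePlateauIdentity
import Summits.NavierStokesRegularity.NavierStokesRegularity.Theorems.ExtremiserTransienceNearExtremalTransienceExtremiserLiouvillePlateauTruncationLimits
import HarnessLib

/-!
# Crux `ExtremiserTransience.NearExtremalTransience` (stmt-NavierStokesRegularity-21883), line `extremiser_liouville`,
# stub K1b — EVERY EXTENDED EXTREMISER HAS A SPEED PLATEAU (no far-field gap needed)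

`--supports stmt-NavierStokesRegularity-21883` (helper).  Author: prover seat `ns-el-k1b` (g2).

`ext_interior_contact_nonempty_of_extremal`: if `v` is smooth, divergence-free, `‖v‖ ≤ M`, `‖Dv‖ ≤ B`,
`Dv, D²v ∈ L²`, `0 < M √Z √W` and `|S(v)| = κ⋆ · M √Z √W` (an *extended extremiser*), then the contact set
`{‖v‖ = M}` has NONEMPTY INTERIOR.  This removes the far-field-gap hypothesis `‖v‖ ≤ M' < M` off a ball of g0's
`ext_interior_contact_nonempty`.

Proof.  If the interior is empty, g0's density argument gives `G = 0` for the density `G` of `ℓ ∘ curl`, where `ℓ` is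
the first-variation functional; hence `ℓ(curl η) = 0` for EVERY smooth compactly supported `η`.  Take `η_R :=
χ_R · conePotential (v − c)` (`c` the far-field limit of `exists_farFieldLimit`): `curl η_R` is the solenoidal
truncation `Ψ_R` of `v − c` (`solenoidalTruncation_eq_curl_cutoff_conePotential`), and `Ψ_R → v − c` in `Ḣ¹ ∩ Ḣ²`
(`tendsto_lintegral_iteratedFDeriv_one_sub` / `_two_sub`).  Passing to the limit (`tendsto_integral_of_sq_dominated`),
`0 = ℓ(v − c) = 3S² − 2κ⋆²M²ZW = S²`, contradicting `S ≠ 0`.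

Consequences (same file): `norm_eq_of_analytic_extremal` — an ANALYTIC extended extremiser has constant speed
`‖v‖ ≡ M`; `stub_noAnalyticExtremal_iff_noConstantSpeedExtremiser` — the registered stub K1b is EQUIVALENT to «no analytic
constant-speed extended extremiser» (the global-plateau case is exactly what remains of K1b).

WHAT THIS IS NOT: a statement about hypothetical extremisers of the sharp stretching inequality; nothing here proves
NS regularity. [folklore]
-/

noncomputable section

open Set Filter Topology MeasureTheory Metric Function
open scoped ENNReal NNReal Topology InnerProductSpace RealInnerProductSpace ContDiff
open Literature.Analysis.FluidPDE Literature.Analysis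

namespace Summit.NavierStokesRegularity.NavierStokesRegularity.Theorems

-- the problem directory repeats the summit name (`NavierStokesRegularity/NavierStokesRegularity`)
set_option linter.dupNamespace false

namespace ExtremiserLiouville

open DepletionLadder.KStar

variable {v : EuclideanSpace ℝ (Fin 3) → EuclideanSpace ℝ (Fin 3)}

/-- **Every extended extremiser has a speed plateau**: the contact set `{‖v‖ = M}` of an extended extremiser has
nonempty interior — WITHOUT the far-field-gap hypothesis of `ext_interior_contact_nonempty`. [folklore] -/
theorem ext_interior_contact_nonempty_of_extremal
    (hv : ContDiff ℝ ∞ v) (hdiv : VectorCalculus.IsDivFree v) {M B : ℝ}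
    (hM : ∀ x, ‖v x‖ ≤ M) (hB : ∀ x, ‖fderiv ℝ v x‖ ≤ B)
    (h1 : ∫⁻ x, ‖iteratedFDeriv ℝ 1 v x‖ₑ ^ 2 < ⊤) (h2 : ∫⁻ x, ‖iteratedFDeriv ℝ 2 v x‖ₑ ^ 2 < ⊤)
    (hpos : 0 < M * Real.sqrt (∫ x, ‖curl v x‖ ^ 2) * Real.sqrt (∫ x, frobeniusNormSq (fderiv ℝ (curl v) x)))
    (hatt : |∫ x, ⟪curl v x, fderiv ℝ v x (curl v x)⟫| = (sInf {κ : ℝ | (∀ (v : EuclideanSpace ℝ (Fin 3) → EuclideanSpace ℝ (Fin 3)) (M B : ℝ), ContDiff ℝ (⊤ : ℕ∞) v → Literature.Analysis.FluidPDE.VectorCalculus.IsDivFree v → (∀ x, ‖v x‖ ≤ M) → (∀ x, ‖fderiv ℝ v x‖ ≤ B) → (∫⁻ x, ‖iteratedFDeriv ℝ 0 v x‖ₑ ^ 2 < ⊤) → (∫⁻ x, ‖iteratedFDeriv ℝ 1 v x‖ₑ ^ 2 < ⊤) → (∫⁻ x, ‖iteratedFDeriv ℝ 2 v x‖ₑ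 ^ 2 < ⊤) → |∫ x, ⟪Literature.Analysis.FluidPDE.curl v x, fderiv ℝ v x (Literature.Analysis.FluidPDE.curl v x)⟫_ℝ| ≤ κ * M * Real.sqrt (∫ x, ‖Literature.Analysis.FluidPDE.curl v x‖ ^ 2) * Real.sqrt (∫ x, Literature.Analysis.FluidPDE.frobeniusNormSq (fderiv ℝ (Literature.Analysis.FluidPDE.curl v) x)))}) * M * Real.sqrt (∫ x, ‖curl v x‖ ^ 2) * Real.sqrt (∫ x, frobeniusNormSq (fderiv ℝ (curl v) x))) :
    (interior {x | ‖v x‖ = M}).Nonempty := by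
  have hext := extendedSharp
  have hK : 0 < (sInf {κ : ℝ | (∀ (v : EuclideanSpace ℝ (Fin 3) → EuclideanSpace ℝ (Fin 3)) (M B : ℝ), ContDiff ℝ (⊤ : ℕ∞) v → Literature.Analysis.FluidPDE.VectorCalculus.IsDivFree v → (∀ x, ‖v x‖ ≤ M) → (∀ x, ‖fderiv ℝ v x‖ ≤ B) → (∫⁻ x, ‖iteratedFDeriv ℝ 0 v x‖ₑ ^ 2 < ⊤) → (∫⁻ x, ‖iteratedFDeriv ℝ 1 v x‖ₑ ^ 2 < ⊤) → (∫⁻ x, ‖iteratedFDeriv ℝ 2 v x‖ₑ ^ 2 < ⊤) → |∫ x, ⟪Literature.Analysis.FluidPDE.curl v x, fderiv ℝ v x (Literature.Analysis.FluidPDE.curl v x)⟫_ℝ| ≤ κ * M * Real.sqrt (∫ x, ‖Literature.Analysis.FluidPDE.curl v x‖ ^ 2) * Real.sqrt (∫ x, Literature.Analysis.FluidPDE.frobeniusNormSq (fderiv ℝ (Literature.Analysis.FluidPDE.curl v) x)))}) := lt_trans (by norm_num) DepletionLadder.sharpDepletion_gt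
  have hZ0 : 0 ≤ ∫ x, ‖curl v x‖ ^ 2 := integral_nonneg fun x => sq_nonneg _
  have hW0 : 0 ≤ ∫ x, frobeniusNormSq (fderiv ℝ (curl v) x) := integral_nonneg fun x => frobeniusNormSq_nonneg _
  -- `S ≠ 0` and `S² = κ⋆² M² Z W`
  have hSpos : 0 < |∫ x, ⟪curl v x, fderiv ℝ v x (curl v x)⟫| := by
    rw [hatt, mul_assoc, mul_assoc]
    refine mul_pos hK ?_
    simpa [mul_assoc] using hpos
  have hS2 : (∫ x, ⟪curl v x, fderiv ℝ v x (curl v x)⟫) ^ 2 =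
      (sInf {κ : ℝ | (∀ (v : EuclideanSpace ℝ (Fin 3) → EuclideanSpace ℝ (Fin 3)) (M B : ℝ), ContDiff ℝ (⊤ : ℕ∞) v → Literature.Analysis.FluidPDE.VectorCalculus.IsDivFree v → (∀ x, ‖v x‖ ≤ M) → (∀ x, ‖fderiv ℝ v x‖ ≤ B) → (∫⁻ x, ‖iteratedFDeriv ℝ 0 v x‖ₑ ^ 2 < ⊤) → (∫⁻ x, ‖iteratedFDeriv ℝ 1 v x‖ₑ ^ 2 < ⊤) → (∫⁻ x, ‖iteratedFDeriv ℝ 2 v x‖ₑ ^ 2 < ⊤) → |∫ x, ⟪Literature.Analysis.FluidPDE.curl v x, fderiv ℝ v x (Literature.Analysis.FluidPDE.curl v x)⟫_ℝ| ≤ κ * M * Real.sqrt (∫ x, ‖Literature.Analysis.FluidPDE.curl v x‖ ^ 2) * Real.sqrt (∫ x, Literature.Analysis.FluidPDE.frobeniusNormSq (fderiv ℝ (Literature.Analysis.FluidPDE.curl v) x)))}) ^ 2 * M ^ 2 * (∫ x, ‖curl v x‖ ^ 2) * (∫ x, frobeniusNormSq (fderiv ℝ (curl v) x)) := by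
    rw [← sq_abs, hatt, mul_pow, mul_pow, mul_pow, Real.sq_sqrt hZ0, Real.sq_sqrt hW0]
  by_contra hne
  rw [not_nonempty_iff_eq_empty, interior_eq_empty_iff_dense_compl] at hne
  have hUeq : ({x | ‖v x‖ = M} : Set (EuclideanSpace ℝ (Fin 3)))ᶜ = {x | ‖v x‖ < M} := by
    ext x
    simp only [mem_compl_iff, mem_setOf_eq]
    exact ⟨fun h => lt_of_le_of_ne (hM x) h, fun h => ne_of_lt h⟩
  rw [hUeq] at hne
  have hUo : IsOpen {x | ‖v x‖ < M} := isOpen_lt (continuous_norm.comp hv.continuous) continuous_const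
  -- the continuous density of `ℓ ∘ curl` (g0's argument, verbatim up to `G = 0`)
  obtain ⟨G, hGc, hG⟩ := exists_density hv (∫ x, ⟪curl v x, fderiv ℝ v x (curl v x)⟫)
    (-((sInf {κ : ℝ | (∀ (v : EuclideanSpace ℝ (Fin 3) → EuclideanSpace ℝ (Fin 3)) (M B : ℝ), ContDiff ℝ (⊤ : ℕ∞) v → Literature.Analysis.FluidPDE.VectorCalculus.IsDivFree v → (∀ x, ‖v x‖ ≤ M) → (∀ x, ‖fderiv ℝ v x‖ ≤ B) → (∫⁻ x, ‖iteratedFDeriv ℝ 0 v x‖ₑ ^ 2 < ⊤) → (∫⁻ x, ‖iteratedFDeriv ℝ 1 v x‖ₑ ^ 2 < ⊤) → (∫⁻ x, ‖iteratedFDeriv ℝ 2 v x‖ₑ ^ 2 < ⊤) → |∫ x, ⟪Literature.Analysis.FluidPDE.curl v x, fderiv ℝ v x (Literature.Analysis.FluidPDE.curl v x)⟫_ℝ| ≤ κ * M * Real.sqrt (∫ x, ‖Literature.Analysis.FluidPDE.curl v x‖ ^ 2) * Real.sqrt (∫ x, Literature.Analysis.FluidPDE.frobeniusNormSq (fderiv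 ℝ (Literature.Analysis.FluidPDE.curl v) x)))}) ^ 2 * M ^ 2 * (∫ x, frobeniusNormSq (fderiv ℝ (curl v) x))))
    (-((sInf {κ : ℝ | (∀ (v : EuclideanSpace ℝ (Fin 3) → EuclideanSpace ℝ (Fin 3)) (M B : ℝ), ContDiff ℝ (⊤ : ℕ∞) v → Literature.Analysis.FluidPDE.VectorCalculus.IsDivFree v → (∀ x, ‖v x‖ ≤ M) → (∀ x, ‖fderiv ℝ v x‖ ≤ B) → (∫⁻ x, ‖iteratedFDeriv ℝ 0 v x‖ₑ ^ 2 < ⊤) → (∫⁻ x, ‖iteratedFDeriv ℝ 1 v x‖ₑ ^ 2 < ⊤) → (∫⁻ x, ‖iteratedFDeriv ℝ 2 v x‖ₑ ^ 2 < ⊤) → |∫ x, ⟪Literature.Analysis.FluidPDE.curl v x, fderiv ℝ v x (Literature.Analysis.FluidPDE.curl v x)⟫_ℝ| ≤ κ * M * Real.sqrt (∫ x, ‖Literature.Analysis.FluidPDE.curl v x‖ ^ 2) * Real.sqrt (∫ x, Literature.Analysis.FluidPDE.frobeniusNormSq (fderiv ℝ (Literature.Analysis.FluidPDE.curl v) x)))})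 ^ 2 * M ^ 2 * (∫ x, ‖curl v x‖ ^ 2)))
  have hℓ : ∀ η : EuclideanSpace ℝ (Fin 3) → EuclideanSpace ℝ (Fin 3), ContDiff ℝ ∞ η → HasCompactSupport η →
      (∫ x, ⟪curl v x, fderiv ℝ v x (curl v x)⟫) * (∫ x, (⟪curl (curl η) x, fderiv ℝ v x (curl v x)⟫ + ⟪curl v x, fderiv ℝ (curl η) x (curl v x)⟫ +
          ⟪curl v x, fderiv ℝ v x (curl (curl η) x)⟫)) - (sInf {κ : ℝ | (∀ (v : EuclideanSpace ℝ (Fin 3) → EuclideanSpace ℝ (Fin 3)) (M B : ℝ), ContDiff ℝ (⊤ : ℕ∞) v → Literature.Analysis.FluidPDE.VectorCalculus.IsDivFree v → (∀ x, ‖v x‖ ≤ M) → (∀ x, ‖fderiv ℝ v x‖ ≤ B) → (∫⁻ x, ‖iteratedFDeriv ℝ 0 v x‖ₑ ^ 2 < ⊤) → (∫⁻ x, ‖iteratedFDeriv ℝ 1 v x‖ₑ ^ 2 < ⊤) → (∫⁻ x, ‖iteratedFDeriv ℝ 2 v x‖ₑ ^ 2 < ⊤) → |∫ x, ⟪Literature.Analysis.FluidPDE.curl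 v x, fderiv ℝ v x (Literature.Analysis.FluidPDE.curl v x)⟫_ℝ| ≤ κ * M * Real.sqrt (∫ x, ‖Literature.Analysis.FluidPDE.curl v x‖ ^ 2) * Real.sqrt (∫ x, Literature.Analysis.FluidPDE.frobeniusNormSq (fderiv ℝ (Literature.Analysis.FluidPDE.curl v) x)))}) ^ 2 * M ^ 2 * ((∫ x, frobeniusNormSq (fderiv ℝ (curl v) x)) * (∫ x, ⟪curl v x, curl (curl η) x⟫) + (∫ x, ‖curl v x‖ ^ 2) * (∫ x, ∑ i, ⟪fderiv ℝ (curl v) x (EuclideanSpace.basisFun (Fin 3) ℝ i),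
          fderiv ℝ (curl (curl η)) x (EuclideanSpace.basisFun (Fin 3) ℝ i)⟫)) = ∫ x, ⟪G x, η x⟫ := by
    intro η hη hηc
    rw [← hG η hη hηc]
    ring
  have hℓ0 : ∀ η : EuclideanSpace ℝ (Fin 3) → EuclideanSpace ℝ (Fin 3), ContDiff ℝ ∞ η → HasCompactSupport η →
      tsupport η ⊆ {x | ‖v x‖ < M} → ∫ x, ⟪G x, η x⟫ = 0 := by
    intro η hη hηc hηU
    have hcη : ContDiff ℝ ∞ (curl η) := contDiff_curl_top hη
    have h := ext_firstVariation_eq_zero_offContact (φ := curl η) hext hv hdiv hM hB h1 h2 hatt hcη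
      (hasCompactSupport_curl hηc) (fun x => divergence_curl_eq_zero_holds η (hη.of_le (by norm_cast)) x)
      ((tsupport_curl_subset η).trans hηU)
    rw [← hℓ η hη hηc, h]
    ring
  have hGae : ∀ᵐ x ∂(volume : Measure (EuclideanSpace ℝ (Fin 3))), x ∈ {x | ‖v x‖ < M} → G x = 0 := by
    refine hUo.ae_eq_zero_of_integral_contDiff_smul_eq_zero (hGc.locallyIntegrable.locallyIntegrableOn _)
      fun θ hθ hθc hθU => ?_
    have hint : Integrable (fun x => θ x • G x) (volume : Measure (EuclideanSpace ℝ (Fin 3))) :=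
      (hθ.continuous.smul hGc).integrable_of_hasCompactSupport hθc.smul_right
    refine ext_inner_left ℝ fun e => ?_
    rw [inner_zero_right, ← integral_inner hint e]
    have hη : ContDiff ℝ ∞ fun x => θ x • e := hθ.smul contDiff_const
    have hηc : HasCompactSupport fun x => θ x • e := hθc.smul_right
    have hηU : tsupport (fun x => θ x • e) ⊆ {x | ‖v x‖ < M} := (tsupport_smul_subset_left _ _).trans hθU
    have hpt : ∀ x, ⟪e, θ x • G x⟫ = ⟪G x, θ x • e⟫ := fun x => by
      rw [inner_smul_right, inner_smul_right, real_inner_comm]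
    rw [integral_congr_ae (Eventually.of_forall hpt)]
    exact hℓ0 _ hη hηc hηU
  have hGU : EqOn G 0 {x | ‖v x‖ < M} :=
    Measure.eqOn_open_of_ae_eq ((ae_restrict_iff' hUo.measurableSet).2 hGae) hUo hGc.continuousOn
      continuousOn_const
  have hG0 : G = 0 := Continuous.ext_on hne hGc continuous_const hGU
  /- NEW PART: the far-field limit `c`, `V := v − c`, and the truncations `Ψ_R = curl (χ_R · conePotential V)` -/
  have hv1 : ContDiff ℝ 1 v := contDiff_infty.1 hv 1
  have hD : ∫⁻ x, ‖fderiv ℝ v x‖ₑ ^ 2 < ⊤ := by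
    refine lt_of_le_of_lt (le_of_eq (lintegral_congr fun x => ?_)) h1
    rw [(enorm_iteratedFDeriv_one_two v x).1]
  obtain ⟨c, -, -, hmem⟩ := exists_farFieldLimit hv1 hM hB hD
  set V : EuclideanSpace ℝ (Fin 3) → EuclideanSpace ℝ (Fin 3) := fun x => v x - c with hVdef
  have hV : ContDiff ℝ (⊤ : ℕ∞) V := hv.sub contDiff_const
  have hVdiv : VectorCalculus.IsDivFree V := isDivFree_sub_const hdiv c
  have hDV : fderiv ℝ V = fderiv ℝ v := funext fun y => fderiv_sub_const c
  have hcurlV : curl V = curl v := curl_sub_const_eq v c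
  have hiter : ∀ n : ℕ, iteratedFDeriv ℝ (n + 1) V = iteratedFDeriv ℝ (n + 1) v := by
    intro n
    ext1 y
    rw [iteratedFDeriv_succ_eq_comp_right, iteratedFDeriv_succ_eq_comp_right]
    simp only [Function.comp, hVdef, fderiv_sub_const]
  have hD1V : ∫⁻ x, ‖iteratedFDeriv ℝ 1 V x‖ₑ ^ 2 < ⊤ := by rw [hiter 0]; exact h1
  have hD2V : ∫⁻ x, ‖iteratedFDeriv ℝ 2 V x‖ₑ ^ 2 < ⊤ := by rw [hiter 1]; exact h2
  have hV6 : ∫⁻ x, ‖V x‖ₑ ^ 6 < ⊤ := by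
    have h := lintegral_rpow_enorm_lt_top_of_eLpNorm_lt_top (by norm_num) (by norm_num) hmem.eLpNorm_lt_top
    simp only [ENNReal.toReal_ofNat] at h
    refine lt_of_le_of_lt (le_of_eq (lintegral_congr fun x => ?_)) h
    rw [show (6 : ℝ) = ((6 : ℕ) : ℝ) by norm_num, ENNReal.rpow_natCast]
  have hBV : ∀ y, ‖fderiv ℝ V y‖ ≤ B := fun y => by rw [hDV]; exact hB y
  -- the three first-variation integrals converge along `Ψ_R := solenoidalTruncation V R`
  have hJ := tendsto_truncation_stretchingVariation hV hBV hV6 hD1V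
  have hA := tendsto_truncation_enstrophyVariation hV hV6 hD1V
  have hC := tendsto_truncation_palinstrophyVariation hV hV6 hD1V hD2V
  rw [hcurlV, hDV] at hJ
  rw [hcurlV] at hA hC
  -- `ℓ(Ψ_R) = 0`, since `Ψ_R = curl (χ_R · conePotential V)` and `G = 0`
  have hℓΨ : ∀ R : ℝ, 0 < R →
      (∫ x, ⟪curl v x, fderiv ℝ v x (curl v x)⟫) * (∫ x, (⟪curl (solenoidalTruncation V R) x, fderiv ℝ v x (curl v x)⟫ +
          ⟪curl v x, fderiv ℝ (solenoidalTruncation V R) x (curl v x)⟫ +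
          ⟪curl v x, fderiv ℝ v x (curl (solenoidalTruncation V R) x)⟫)) - (sInf {κ : ℝ | (∀ (v : EuclideanSpace ℝ (Fin 3) → EuclideanSpace ℝ (Fin 3)) (M B : ℝ), ContDiff ℝ (⊤ : ℕ∞) v → Literature.Analysis.FluidPDE.VectorCalculus.IsDivFree v → (∀ x, ‖v x‖ ≤ M) → (∀ x, ‖fderiv ℝ v x‖ ≤ B) → (∫⁻ x, ‖iteratedFDeriv ℝ 0 v x‖ₑ ^ 2 < ⊤) → (∫⁻ x, ‖iteratedFDeriv ℝ 1 v x‖ₑ ^ 2 < ⊤) → (∫⁻ x, ‖iteratedFDeriv ℝ 2 v x‖ₑ ^ 2 < ⊤) → |∫ x, ⟪Literature.Analysis.FluidPDE.curl v x, fderiv ℝ v x (Literature.Analysis.FluidPDE.curl v x)⟫_ℝ| ≤ κ * M * Real.sqrt (∫ x, ‖Literature.Analysis.FluidPDE.curl v x‖ ^ 2) * Real.sqrt (∫ x, Literature.Analysis.FluidPDE.frobeniusNormSq (fderiv ℝ (Literature.Analysis.FluidPDE.curl v) x)))}) ^ 2 * M ^ 2 * ((∫ x, frobeniusNormSq (fderiv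 ℝ (curl v) x)) * (∫ x, ⟪curl v x, curl (solenoidalTruncation V R) x⟫) + (∫ x, ‖curl v x‖ ^ 2) * (∫ x, ∑ i, ⟪fderiv ℝ (curl v) x (EuclideanSpace.basisFun (Fin 3) ℝ i),
          fderiv ℝ (curl (solenoidalTruncation V R)) x (EuclideanSpace.basisFun (Fin 3) ℝ i)⟫)) = 0 := by
    intro R hR
    have hη : ContDiff ℝ ∞ fun y => cutoff R y • conePotential V y := (contDiff_cutoff R).smul (contDiff_conePotential hV)
    have hηc : HasCompactSupport fun y => cutoff R y • conePotential V y := (hasCompactSupport_cutoff hR).smul_right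
    have hΨη : solenoidalTruncation V R = curl (fun y => cutoff R y • conePotential V y) :=
      solenoidalTruncation_eq_curl_cutoff_conePotential hV hVdiv R
    have h := hℓ _ hη hηc
    rw [hG0, ← hΨη] at h
    rw [h]
    simp
  -- pass to the limit: `0 = ℓ(V) = 3S² − 2κ⋆²M²ZW = S²`
  have hlim := (hJ.const_mul (∫ x, ⟪curl v x, fderiv ℝ v x (curl v x)⟫)).sub
    (((hA.const_mul (∫ x, frobeniusNormSq (fderiv ℝ (curl v) x))).add
      (hC.const_mul (∫ x, ‖curl v x‖ ^ 2))).const_mul ((sInf {κ : ℝ | (∀ (v : EuclideanSpace ℝ (Fin 3) → EuclideanSpace ℝ (Fin 3)) (M B : ℝ), ContDiff ℝ (⊤ : ℕ∞) v → Literature.Analysis.FluidPDE.VectorCalculus.IsDivFree v → (∀ x, ‖v x‖ ≤ M) → (∀ x, ‖fderiv ℝ v x‖ ≤ B) → (∫⁻ x, ‖iteratedFDeriv ℝ 0 v x‖ₑ ^ 2 < ⊤) → (∫⁻ x, ‖iteratedFDeriv ℝ 1 v x‖ₑ ^ 2 < ⊤) → (∫⁻ x, ‖iteratedFDeriv ℝ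 2 v x‖ₑ ^ 2 < ⊤) → |∫ x, ⟪Literature.Analysis.FluidPDE.curl v x, fderiv ℝ v x (Literature.Analysis.FluidPDE.curl v x)⟫_ℝ| ≤ κ * M * Real.sqrt (∫ x, ‖Literature.Analysis.FluidPDE.curl v x‖ ^ 2) * Real.sqrt (∫ x, Literature.Analysis.FluidPDE.frobeniusNormSq (fderiv ℝ (Literature.Analysis.FluidPDE.curl v) x)))}) ^ 2 * M ^ 2))
  have hzero := hlim.congr' ((eventually_gt_atTop 0).mono fun R hR => hℓΨ R hR)
  have hL := tendsto_nhds_unique hzero tendsto_const_nhds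
  have hS0 : (∫ x, ⟪curl v x, fderiv ℝ v x (curl v x)⟫) ^ 2 = 0 := by nlinarith [hL, hS2]
  have h' := pow_pos hSpos 2
  rw [sq_abs, hS0] at h'
  exact lt_irrefl _ h'

/-! ## Consequences: analytic extended extremisers have constant speed; K1b ⟺ «no constant-speed analytic extremiser» -/

/-- **An analytic extended extremiser has constant speed `‖v‖ ≡ M`.**  (Plateau with nonempty interior + analyticity of
`‖v‖²` + identity theorem.) [folklore] -/
theorem norm_eq_of_analytic_extremal
    (hv : ContDiff ℝ ∞ v) (han : AnalyticOnNhd ℝ v univ) (hdiv : VectorCalculus.IsDivFree v) {M B : ℝ}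
    (hM : ∀ x, ‖v x‖ ≤ M) (hB : ∀ x, ‖fderiv ℝ v x‖ ≤ B)
    (h1 : ∫⁻ x, ‖iteratedFDeriv ℝ 1 v x‖ₑ ^ 2 < ⊤) (h2 : ∫⁻ x, ‖iteratedFDeriv ℝ 2 v x‖ₑ ^ 2 < ⊤)
    (hpos : 0 < M * Real.sqrt (∫ x, ‖curl v x‖ ^ 2) * Real.sqrt (∫ x, frobeniusNormSq (fderiv ℝ (curl v) x)))
    (hatt : |∫ x, ⟪curl v x, fderiv ℝ v x (curl v x)⟫| = (sInf {κ : ℝ | (∀ (v : EuclideanSpace ℝ (Fin 3) → EuclideanSpace ℝ (Fin 3)) (M B : ℝ), ContDiff ℝ (⊤ : ℕ∞) v → Literature.Analysis.FluidPDE.VectorCalculus.IsDivFree v → (∀ x, ‖v x‖ ≤ M) → (∀ x, ‖fderiv ℝ v x‖ ≤ B) → (∫⁻ x, ‖iteratedFDeriv ℝ 0 v x‖ₑ ^ 2 < ⊤) → (∫⁻ x, ‖iteratedFDeriv ℝ 1 v x‖ₑ ^ 2 < ⊤) → (∫⁻ x, ‖iteratedFDeriv ℝ 2 v x‖ₑ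 ^ 2 < ⊤) → |∫ x, ⟪Literature.Analysis.FluidPDE.curl v x, fderiv ℝ v x (Literature.Analysis.FluidPDE.curl v x)⟫_ℝ| ≤ κ * M * Real.sqrt (∫ x, ‖Literature.Analysis.FluidPDE.curl v x‖ ^ 2) * Real.sqrt (∫ x, Literature.Analysis.FluidPDE.frobeniusNormSq (fderiv ℝ (Literature.Analysis.FluidPDE.curl v) x)))}) * M * Real.sqrt (∫ x, ‖curl v x‖ ^ 2) * Real.sqrt (∫ x, frobeniusNormSq (fderiv ℝ (curl v) x))) :
    ∀ x, ‖v x‖ = M := by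
  obtain ⟨x₀, hx₀⟩ := ext_interior_contact_nonempty_of_extremal hv hdiv hM hB h1 h2 hpos hatt
  have hsq : AnalyticOnNhd ℝ (fun x => ‖v x‖ ^ 2) univ := by
    have hcoord : ∀ i : Fin 3, AnalyticOnNhd ℝ (fun x => v x i) univ := fun i =>
      (EuclideanSpace.proj i : EuclideanSpace ℝ (Fin 3) →L[ℝ] ℝ).comp_analyticOnNhd han
    have heq : (fun x => ‖v x‖ ^ 2) = fun x => ∑ i, v x i * v x i := by
      funext x
      rw [EuclideanSpace.norm_eq, Real.sq_sqrt (Finset.sum_nonneg fun i _ => sq_nonneg _)]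
      exact Finset.sum_congr rfl fun i _ => by rw [Real.norm_eq_abs, sq_abs, sq]
    rw [heq]
    exact Finset.analyticOnNhd_fun_sum _ fun i _ => (hcoord i).mul (hcoord i)
  have hev : (fun x => ‖v x‖ ^ 2) =ᶠ[𝓝 x₀] fun _ => M ^ 2 := by
    filter_upwards [mem_interior_iff_mem_nhds.1 hx₀] with x hx
    have hx' : ‖v x‖ = M := hx
    rw [hx']
  have hconst : (fun x => ‖v x‖ ^ 2) = fun _ => M ^ 2 := hsq.eq_of_eventuallyEq analyticOnNhd_const hev
  have hM0 : 0 ≤ M := (norm_nonneg _).trans (hM 0)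
  intro x
  exact (pow_left_inj₀ (norm_nonneg _) hM0 two_ne_zero).1 (congrFun hconst x)

/-- **K1b ⟺ «no analytic CONSTANT-SPEED extended extremiser».**  The registered stub `stub_noAnalyticExtremal` (left) is
equivalent to the same statement with `‖w‖ ≤ M` replaced by `‖w‖ ≡ M` (right): `⇒` is trivial, `⇐` is
`norm_eq_of_analytic_extremal` + the extended sharp inequality `extendedSharp`.  The constant-speed case is what remains of
K1b. [folklore] -/
theorem stub_noAnalyticExtremal_iff_noConstantSpeedExtremiser :
    (¬ ∃ (w : EuclideanSpace ℝ (Fin 3) → EuclideanSpace ℝ (Fin 3)), AnalyticOnNhd ℝ w Set.univ ∧ (ContDiff ℝ (⊤ : ℕ∞) w ∧ Literature.Analysis.FluidPDE.VectorCalculus.IsDivFree w ∧ (∃ B : ℝ, ∀ x, ‖fderiv ℝ w x‖ ≤ B) ∧ (∫⁻ x, ‖iteratedFDeriv ℝ 1 w x‖ₑ ^ 2 < ⊤) ∧ (∫⁻ x, ‖iteratedFDeriv ℝ 2 w x‖ₑ ^ 2 < ⊤) ∧ ∃ M : ℝ, (∀ x, ‖w x‖ ≤ M) ∧ 0 < M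 * Real.sqrt (∫ x, ‖Literature.Analysis.FluidPDE.curl w x‖ ^ 2) * Real.sqrt (∫ x, Literature.Analysis.FluidPDE.frobeniusNormSq (fderiv ℝ (Literature.Analysis.FluidPDE.curl w) x)) ∧ (sInf {κ : ℝ | (∀ (v : EuclideanSpace ℝ (Fin 3) → EuclideanSpace ℝ (Fin 3)) (M B : ℝ), ContDiff ℝ (⊤ : ℕ∞) v → Literature.Analysis.FluidPDE.VectorCalculus.IsDivFree v → (∀ x, ‖v x‖ ≤ M) → (∀ x, ‖fderiv ℝ v x‖ ≤ B) → (∫⁻ x, ‖iteratedFDeriv ℝ 0 v x‖ₑ ^ 2 < ⊤) → (∫⁻ x, ‖iteratedFDeriv ℝ 1 v x‖ₑ ^ 2 < ⊤) → (∫⁻ x, ‖iteratedFDeriv ℝ 2 v x‖ₑ ^ 2 < ⊤) → |∫ x, ⟪Literature.Analysis.FluidPDE.curl v x, fderiv ℝ v x (Literature.Analysis.FluidPDE.curl v x)⟫_ℝ| ≤ κ * M * Real.sqrt (∫ x, ‖Literature.Analysis.FluidPDE.curl v x‖ ^ 2) * Real.sqrt (∫ x, Literature.Analysis.FluidPDE.frobeniusNormSq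 (fderiv ℝ (Literature.Analysis.FluidPDE.curl v) x)))}) * M * Real.sqrt (∫ x, ‖Literature.Analysis.FluidPDE.curl w x‖ ^ 2) * Real.sqrt (∫ x, Literature.Analysis.FluidPDE.frobeniusNormSq (fderiv ℝ (Literature.Analysis.FluidPDE.curl w) x)) ≤ |∫ x, ⟪Literature.Analysis.FluidPDE.curl w x, fderiv ℝ w x (Literature.Analysis.FluidPDE.curl w x)⟫_ℝ|)) ↔
    (¬ ∃ (w : EuclideanSpace ℝ (Fin 3) → EuclideanSpace ℝ (Fin 3)), AnalyticOnNhd ℝ w Set.univ ∧ (ContDiff ℝ (⊤ : ℕ∞) w ∧ Literature.Analysis.FluidPDE.VectorCalculus.IsDivFree w ∧ (∃ B : ℝ, ∀ x, ‖fderiv ℝ w x‖ ≤ B) ∧ (∫⁻ x, ‖iteratedFDeriv ℝ 1 w x‖ₑ ^ 2 < ⊤) ∧ (∫⁻ x, ‖iteratedFDeriv ℝ 2 w x‖ₑ ^ 2 < ⊤) ∧ ∃ M : ℝ, (∀ x, ‖w x‖ = M) ∧ 0 < M * Real.sqrt (∫ x, ‖Literature.Analysis.FluidPDE.curl w x‖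 ^ 2) * Real.sqrt (∫ x, Literature.Analysis.FluidPDE.frobeniusNormSq (fderiv ℝ (Literature.Analysis.FluidPDE.curl w) x)) ∧ (sInf {κ : ℝ | (∀ (v : EuclideanSpace ℝ (Fin 3) → EuclideanSpace ℝ (Fin 3)) (M B : ℝ), ContDiff ℝ (⊤ : ℕ∞) v → Literature.Analysis.FluidPDE.VectorCalculus.IsDivFree v → (∀ x, ‖v x‖ ≤ M) → (∀ x, ‖fderiv ℝ v x‖ ≤ B) → (∫⁻ x, ‖iteratedFDeriv ℝ 0 v x‖ₑ ^ 2 < ⊤) → (∫⁻ x, ‖iteratedFDeriv ℝ 1 v x‖ₑ ^ 2 < ⊤) → (∫⁻ x, ‖iteratedFDeriv ℝ 2 v x‖ₑ ^ 2 < ⊤) → |∫ x, ⟪Literature.Analysis.FluidPDE.curl v x, fderiv ℝ v x (Literature.Analysis.FluidPDE.curl v x)⟫_ℝ| ≤ κ * M * Real.sqrt (∫ x, ‖Literature.Analysis.FluidPDE.curl v x‖ ^ 2) * Real.sqrt (∫ x, Literature.Analysis.FluidPDE.frobeniusNormSq (fderiv ℝ (Literature.Analysis.FluidPDE.curl v)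 x)))}) * M * Real.sqrt (∫ x, ‖Literature.Analysis.FluidPDE.curl w x‖ ^ 2) * Real.sqrt (∫ x, Literature.Analysis.FluidPDE.frobeniusNormSq (fderiv ℝ (Literature.Analysis.FluidPDE.curl w) x)) ≤ |∫ x, ⟪Literature.Analysis.FluidPDE.curl w x, fderiv ℝ w x (Literature.Analysis.FluidPDE.curl w x)⟫_ℝ|)) := by
  constructor
  · rintro h ⟨w, han, hcd, hdiv, hBex, h1, h2, M, hM, hpos, hge⟩
    exact h ⟨w, han, hcd, hdiv, hBex, h1, h2, M, fun x => (hM x).le, hpos, hge⟩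
  · rintro h ⟨w, han, hcd, hdiv, ⟨B, hB⟩, h1, h2, M, hM, hpos, hge⟩
    have hle := extendedSharp w M B hcd hdiv hM hB h1 h2
    have heq := le_antisymm hge hle
    have hcs := norm_eq_of_analytic_extremal hcd han hdiv hM hB h1 h2 hpos heq.symm
    exact h ⟨w, han, hcd, hdiv, ⟨B, hB⟩, h1, h2, M, hcs, hpos, hge⟩

end ExtremiserLiouville

end Summit.NavierStokesRegularity.NavierStokesRegularity.Theorems

end
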